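import Literature.NumberTheory.Transcendental.NesterenkoUResultantDegree
import Literature.NumberTheory.Transcendental.NesterenkoGenericSplitting
import HarnessLib

/-!
# Barrier (Schanuel) `NesterenkoModularScope`: the `u`-resultant lies in the elimination ideal of `(𝔭, Q)` (Zhu, Lemma 2.3.3 (i))

Proofs-only; no definitions, nothing asserted.

For a homogeneous prime `𝔭 ⊂ ℚ[x₀, …, x_m]` of rank `s + 1` (`1 ≤ s`, `s + 1 ≤ m`), a form `Q ∉ 𝔭`
of degree `d` with integer model `Q₀`, and the `u`-resultant `G = uResultant 𝔭 s d Q₀ ∈ ℚ[u₁, …, u_s]`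
(`NesterenkoUResultantIntegral.lean`: `G = c^d ∏_{i<D} Q₀(β⁽ⁱ⁾)` over the `D = deg 𝔭` points of the
generic linear section), we prove **`G ∈ ((𝔭, Q))‾(s)`**, i.e. `G x_k^M ∈ (𝔭, Q, L₁, …, L_s)` for all
`k` (Zhu Yaochen, *Algebraic independence* (Chinese), Lemma 2.3.3 (i); Nesterenko 1977, Lemma 6):

* the polynomial `S(T) = c^d ∏ᵢ (Q₀(β⁽ⁱ⁾) − T β⁽ⁱ⁾ₖ^d) ∈ Ω[T]` takes at every integer `t` the
  value `G_t = uResultant 𝔭 s d (Q₀ − t x_k^d) ∈ ℚ[u]`, so (interpolation) all its coefficients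
  `s_t` lie in `ℚ[u]`, `s₀ = G`;
* `P_k = ∑_t s_t Q₀^t x_k^{d(D−t)} ∈ ℚ[u][x̲]` satisfies `P_k − x_k^{dD} G ∈ (Q₀)` and vanishes at
  the generic point of the linear section: pushing the generic point `ρ` of
  `NesterenkoGenericSectionField.lean` into `Ω` by an embedding `ψ : 𝕃₀ → Ω` gives a point
  proportional to some `β⁽ⁱ⁰⁾`, at which the `i₀`-th factor of the homogenised product vanishes;
  hence `Φⱼ(P_k) = 0` and `x_k^N P_k ∈ (𝔭, L₁, …, L_s)` (`exists_pow_mul_mem_extIdeal`).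

## References

* Zhu Yaochen, *Transcendental numbers: algebraic independence* (in Chinese), USTC Press,
  Lemma 2.3.3 (i) and its proof ((2.3.5)–(2.3.10)).
* [Nesterenko1977] Yu. V. Nesterenko, Izv. Akad. Nauk SSSR Ser. Mat. 41 (1977), §2, Lemma 6.
* [NesterenkoPhilippon2001] LNM 1752 (2001), Ch. 3 §4 (Def. 4.3, Prop. 4.11).
-/

noncomputable section

open MvPolynomial

attribute [local instance] MvPolynomial.gradedAlgebra

namespace Literature.NumberTheory.Transcendental

namespace Nesterenko

variable {m : ℕ}

/-! ### Interpolation: a polynomial with many values in a `ℚ`-subspace has its coefficients there -/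

section Interpolation

variable {K : Type*} [Field K] [Algebra ℚ K]

/-- **Interpolation over `ℤ`**: if `f ∈ K[T]` has `deg f ≤ D` and `f(t)` lies in the `ℚ`-subspace
`W` of `K` for every integer `t` outside a finite set, then every coefficient of `f` lies in `W`
(induction on `D`: `f = f(t₀) + (T − t₀) h`). [folklore] -/
theorem coeff_mem_of_eval_int_mem (W : Submodule ℚ K) :
    ∀ (D : ℕ) (S : Finset ℤ) (f : Polynomial K), f.natDegree ≤ D →
      (∀ t : ℤ, t ∉ S → f.eval (algebraMap ℚ K t) ∈ W) → ∀ n, f.coeff n ∈ W := by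
  intro D
  induction D with
  | zero =>
    intro S f hf hval n
    obtain ⟨t, ht⟩ := Infinite.exists_notMem_finset S
    have hC : f = Polynomial.C (f.coeff 0) := Polynomial.eq_C_of_natDegree_le_zero hf
    rcases Nat.eq_zero_or_pos n with rfl | hn
    · have h := hval t ht
      rw [hC, Polynomial.eval_C] at h
      exact h
    · rw [hC, Polynomial.coeff_C, if_neg hn.ne']
      exact W.zero_mem
  | succ D ih =>
    intro S f hf hval n
    obtain ⟨t₀, ht₀⟩ := Infinite.exists_notMem_finset S
    set c : K := algebraMap ℚ K t₀ with hc
    -- `f = C (f c) + (X - C c) * h`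
    set g : Polynomial K := f - Polynomial.C (f.eval c) with hg
    have hroot : g.IsRoot c := by simp [hg]
    have hdvd : (Polynomial.X - Polynomial.C c) ∣ g := Polynomial.dvd_iff_isRoot.mpr hroot
    set h : Polynomial K := g /ₘ (Polynomial.X - Polynomial.C c) with hh
    have hgh : (Polynomial.X - Polynomial.C c) * h = g := by
      rw [hh]
      exact (Polynomial.mul_divByMonic_eq_iff_isRoot).mpr hroot
    have hhdeg : h.natDegree ≤ D := by
      rw [hh, Polynomial.natDegree_divByMonic _ (Polynomial.monic_X_sub_C c),
        Polynomial.natDegree_X_sub_C]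
      have : g.natDegree ≤ D + 1 := by
        rw [hg]
        exact (Polynomial.natDegree_sub_le _ _).trans (by simp [hf])
      omega
    -- values of `h`
    have hvalh : ∀ t : ℤ, t ∉ insert t₀ S → h.eval (algebraMap ℚ K t) ∈ W := by
      intro t ht
      rw [Finset.mem_insert, not_or] at ht
      have hne : ((t : ℚ) - t₀) ≠ 0 := by
        have : (t : ℚ) ≠ t₀ := by exact_mod_cast ht.1
        exact sub_ne_zero.mpr this
      have hev := congrArg (Polynomial.eval (algebraMap ℚ K t)) hgh
      rw [Polynomial.eval_mul, Polynomial.eval_sub, Polynomial.eval_X, Polynomial.eval_C, hg,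
        Polynomial.eval_sub, Polynomial.eval_C] at hev
      -- `(t - t₀) h(t) = f(t) - f(t₀)`
      have hdiff : f.eval (algebraMap ℚ K t) - f.eval c ∈ W := W.sub_mem (hval t ht.2) (hval t₀ ht₀)
      have key : h.eval (algebraMap ℚ K t) =
          ((t : ℚ) - t₀)⁻¹ • (f.eval (algebraMap ℚ K t) - f.eval c) := by
        rw [← hev, hc, ← map_sub, Algebra.smul_def, ← mul_assoc, ← map_mul,
          show (((t : ℚ) - t₀)⁻¹ * ((t : ℚ) - (t₀ : ℚ))) = 1 from inv_mul_cancel₀ hne, map_one, one_mul]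
      rw [key]
      exact W.smul_mem _ hdiff
    have hcoef := ih (insert t₀ S) h hhdeg hvalh
    -- coefficients of `f = C (f c) + (X - C c) * h`
    have hf_eq : f = Polynomial.C (f.eval c) + (Polynomial.X - Polynomial.C c) * h := by
      rw [hgh, hg]; ring
    have hcW : ∀ w ∈ W, c * w ∈ W := fun w hw => by
      rw [hc, ← Algebra.smul_def]; exact W.smul_mem _ hw
    rw [hf_eq, Polynomial.coeff_add, Polynomial.coeff_C, mul_comm]
    cases n with
    | zero =>
      rw [if_pos rfl, Polynomial.mul_coeff_zero, Polynomial.coeff_sub, Polynomial.coeff_X_zero,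
        Polynomial.coeff_C_zero, zero_sub, mul_neg, ← neg_mul, mul_comm]
      refine W.add_mem (hval t₀ ht₀) ?_
      rw [mul_comm, neg_mul, ← mul_neg]
      -- `-(h₀ c)`? normalise to `c * (-h₀)`
      have : h.coeff 0 * -c = c * (-h.coeff 0) := by ring
      rw [this]
      exact hcW _ (W.neg_mem (hcoef 0))
    | succ a =>
      rw [if_neg (Nat.succ_ne_zero a), zero_add, Polynomial.coeff_mul_X_sub_C]
      refine W.sub_mem (hcoef a) ?_
      rw [mul_comm]
      exact hcW _ (hcoef (a + 1))

end Interpolation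

/-! ### The polynomial `S(T) = c^d ∏ᵢ (Q₀(β⁽ⁱ⁾) − T β⁽ⁱ⁾ₖ^d)` and its coefficients -/

section SPoly

variable {s : ℕ} {𝔭 : Ideal (Rx m)}

/-- Integer polynomials are evaluated through `Int.castRingHom`, whatever the `ℤ`-algebra structure.
[folklore] -/
theorem aeval_eq_eval₂Hom_int {A : Type*} [CommRing A] {inst : Algebra ℤ A} {σ : Type*} (f : σ → A)
    (p : MvPolynomial σ ℤ) : @MvPolynomial.aeval ℤ A σ _ _ inst f p = MvPolynomial.eval₂Hom (Int.castRingHom A) f p := by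
  rw [MvPolynomial.coe_eval₂Hom, MvPolynomial.aeval_def]
  congr 1
  exact RingHom.ext_int _ _

/-- `S(t) = res(Q₀ − t x_k^d)` for integers `t`: the value of `S` at an integer is the `u`-resultant
over `Ω` of `𝔭` with the integer form `Q₀ − t x_k^d`. [folklore] -/
theorem eval_SPoly_intCast (d : ℕ) (Q₀ : MvPolynomial (Fin (m + 1)) ℤ) (k : Fin (m + 1)) (t : ℤ) :
    (Polynomial.C (splitConst 𝔭 s ^ d) *
        ∏ i, (Polynomial.C (MvPolynomial.eval₂Hom (Int.castRingHom (ΩU s m)) (splitPts 𝔭 s i) Q₀) -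
          Polynomial.X * Polynomial.C (splitPts 𝔭 s i k ^ d))).eval (t : ΩU s m) =
      uResΩ 𝔭 s d (Q₀ - (t : MvPolynomial (Fin (m + 1)) ℤ) * MvPolynomial.X k ^ d) := by
  rw [uResΩ, splitNorm_def, Polynomial.eval_mul, Polynomial.eval_C, Polynomial.eval_prod]
  congr 1
  refine Finset.prod_congr rfl fun i _ => ?_
  rw [Polynomial.eval_sub, Polynomial.eval_C, Polynomial.eval_mul, Polynomial.eval_X, Polynomial.eval_C,
    aeval_eq_eval₂Hom_int, map_sub, map_mul, map_pow, map_intCast, MvPolynomial.eval₂Hom_X']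

/-- `deg S ≤ D`. [folklore] -/
theorem natDegree_SPoly_le (d : ℕ) (Q₀ : MvPolynomial (Fin (m + 1)) ℤ) (k : Fin (m + 1)) :
    (Polynomial.C (splitConst 𝔭 s ^ d) *
        ∏ i, (Polynomial.C (MvPolynomial.eval₂Hom (Int.castRingHom (ΩU s m)) (splitPts 𝔭 s i) Q₀) -
          Polynomial.X * Polynomial.C (splitPts 𝔭 s i k ^ d))).natDegree ≤ ideg 𝔭 (s + 1) := by
  refine (Polynomial.natDegree_C_mul_le _ _).trans ?_
  refine (Polynomial.natDegree_prod_le _ _).trans ?_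
  calc ∑ i : Fin (ideg 𝔭 (s + 1)), (Polynomial.C (MvPolynomial.eval₂Hom (Int.castRingHom (ΩU s m))
          (splitPts 𝔭 s i) Q₀) - Polynomial.X * Polynomial.C (splitPts 𝔭 s i k ^ d)).natDegree
        ≤ ∑ _i : Fin (ideg 𝔭 (s + 1)), 1 := by
          refine Finset.sum_le_sum fun i _ => ?_
          refine (Polynomial.natDegree_sub_le _ _).trans ?_
          rw [Polynomial.natDegree_C, Nat.zero_max]
          refine (Polynomial.natDegree_mul_le).trans ?_
          rw [Polynomial.natDegree_X, Polynomial.natDegree_C]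
    _ = ideg 𝔭 (s + 1) := by simp

/-- **The coefficients of `S` are polynomials in `u`** (`s_t ∈ ℚ[u₁, …, u_s]`), with `s₀ = G`
the `u`-resultant: interpolation through the integer values `S(t) = G_t ∈ ℚ[u]`.
[cite: Nesterenko1977, §2 Lemma 6] -/
theorem exists_SPoly_coeff (h𝔭 : 𝔭.IsPrime)
    (hhom : 𝔭.IsHomogeneous (homogeneousSubmodule (Fin (m + 1)) ℚ))
    (hdim : ringKrullDim (Rx m ⧸ 𝔭) = (s + 1 : ℕ)) {d : ℕ} {Q₀ : MvPolynomial (Fin (m + 1)) ℤ}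
    (hQ₀ : Q₀.IsHomogeneous d) (k : Fin (m + 1)) :
    ∃ sc : ℕ → RU s m, (∀ n, algebraMap (RU s m) (ΩU s m) (sc n) =
        (Polynomial.C (splitConst 𝔭 s ^ d) *
          ∏ i, (Polynomial.C (MvPolynomial.eval₂Hom (Int.castRingHom (ΩU s m)) (splitPts 𝔭 s i) Q₀) -
            Polynomial.X * Polynomial.C (splitPts 𝔭 s i k ^ d))).coeff n) ∧
      sc 0 = uResultant 𝔭 s d Q₀ := by
  classical
  set S := Polynomial.C (splitConst 𝔭 s ^ d) *
    ∏ i, (Polynomial.C (MvPolynomial.eval₂Hom (Int.castRingHom (ΩU s m)) (splitPts 𝔭 s i) Q₀) -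
      Polynomial.X * Polynomial.C (splitPts 𝔭 s i k ^ d)) with hS
  -- the `ℚ`-subspace `ℚ[u] ⊆ Ω`
  set W : Submodule ℚ (ΩU s m) := LinearMap.range ((Algebra.linearMap (RU s m) (ΩU s m)).restrictScalars ℚ)
    with hW
  have hmemW : ∀ x, x ∈ W ↔ ∃ a : RU s m, algebraMap (RU s m) (ΩU s m) a = x := fun x => by
    rw [hW, LinearMap.mem_range]; rfl
  -- integer values lie in `W`
  have hval : ∀ t : ℤ, t ∉ (∅ : Finset ℤ) → S.eval (algebraMap ℚ (ΩU s m) t) ∈ W := by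
    intro t _
    rw [hmemW, map_intCast, hS, eval_SPoly_intCast]
    have hmon : ((t : MvPolynomial (Fin (m + 1)) ℤ) * MvPolynomial.X k ^ d).IsHomogeneous d := by
      have h := (MvPolynomial.isHomogeneous_C (Fin (m + 1)) t).mul ((MvPolynomial.isHomogeneous_X ℤ k).pow d)
      rw [zero_add, one_mul] at h
      rwa [← eq_intCast (MvPolynomial.C : ℤ →+* MvPolynomial (Fin (m + 1)) ℤ) t]
    exact ⟨_, algebraMap_uResultant h𝔭 hhom hdim (hQ₀.sub hmon)⟩
  have hcoef := coeff_mem_of_eval_int_mem W (ideg 𝔭 (s + 1)) ∅ S (natDegree_SPoly_le d Q₀ k) hval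
  choose sc hsc using fun n => (hmemW _).mp (hcoef n)
  refine ⟨fun n => if n = 0 then uResultant 𝔭 s d Q₀ else sc n, fun n => ?_, by simp⟩
  by_cases hn : n = 0
  · subst hn
    simp only [if_true]
    rw [Polynomial.coeff_zero_eq_eval_zero, algebraMap_uResultant h𝔭 hhom hdim hQ₀]
    have h := eval_SPoly_intCast (𝔭 := 𝔭) (s := s) d Q₀ k 0
    simp only [Int.cast_zero, zero_mul, sub_zero] at h
    rw [hS, h]
  · simp only [hn, if_false]
    exact hsc n

end SPoly

/-! ### The homogenised identity `∑ s_t y^t z^{D−t} = c^d ∏ᵢ (Q₀(β⁽ⁱ⁾) z − y β⁽ⁱ⁾ₖ^d)` -/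

section Homog

variable {s : ℕ} {𝔭 : Ideal (Rx m)}

/-- **Homogenisation of `S`**: for all `y, z ∈ Ω`,
`∑_t s_t y^t z^{D−t} = c^d ∏ᵢ (Q₀(β⁽ⁱ⁾) z − y β⁽ⁱ⁾ₖ^d)` (for `z ≠ 0` this is `z^D S(y/z)`, and both
sides are polynomial in `z`). [folklore] -/
theorem SPoly_homog (d : ℕ) (Q₀ : MvPolynomial (Fin (m + 1)) ℤ) (k : Fin (m + 1)) (y z : ΩU s m) :
    ∑ t ∈ Finset.range (ideg 𝔭 (s + 1) + 1),
        (Polynomial.C (splitConst 𝔭 s ^ d) *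
          ∏ i, (Polynomial.C (MvPolynomial.eval₂Hom (Int.castRingHom (ΩU s m)) (splitPts 𝔭 s i) Q₀) -
            Polynomial.X * Polynomial.C (splitPts 𝔭 s i k ^ d))).coeff t * y ^ t * z ^ (ideg 𝔭 (s + 1) - t) =
      splitConst 𝔭 s ^ d * ∏ i, (MvPolynomial.eval₂Hom (Int.castRingHom (ΩU s m)) (splitPts 𝔭 s i) Q₀ * z -
        y * splitPts 𝔭 s i k ^ d) := by
  classical
  set D := ideg 𝔭 (s + 1) with hD
  set S := Polynomial.C (splitConst 𝔭 s ^ d) *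
    ∏ i, (Polynomial.C (MvPolynomial.eval₂Hom (Int.castRingHom (ΩU s m)) (splitPts 𝔭 s i) Q₀) -
      Polynomial.X * Polynomial.C (splitPts 𝔭 s i k ^ d)) with hS
  -- both sides as polynomials in `z`
  set L : Polynomial (ΩU s m) := ∑ t ∈ Finset.range (D + 1), Polynomial.C (S.coeff t * y ^ t) * Polynomial.X ^ (D - t)
    with hL
  set R : Polynomial (ΩU s m) := Polynomial.C (splitConst 𝔭 s ^ d) *
    ∏ i, (Polynomial.C (MvPolynomial.eval₂Hom (Int.castRingHom (ΩU s m)) (splitPts 𝔭 s i) Q₀) * Polynomial.X -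
      Polynomial.C (y * splitPts 𝔭 s i k ^ d)) with hR
  have hLe : ∀ w, L.eval w = ∑ t ∈ Finset.range (D + 1), S.coeff t * y ^ t * w ^ (D - t) := by
    intro w
    rw [hL, Polynomial.eval_finsetSum]
    refine Finset.sum_congr rfl fun t _ => ?_
    rw [Polynomial.eval_mul, Polynomial.eval_C, Polynomial.eval_pow, Polynomial.eval_X]
  have hRe : ∀ w, R.eval w = splitConst 𝔭 s ^ d *
      ∏ i, (MvPolynomial.eval₂Hom (Int.castRingHom (ΩU s m)) (splitPts 𝔭 s i) Q₀ * w - y * splitPts 𝔭 s i k ^ d) := by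
    intro w
    rw [hR, Polynomial.eval_mul, Polynomial.eval_C, Polynomial.eval_prod]
    congr 1
    refine Finset.prod_congr rfl fun i _ => ?_
    rw [Polynomial.eval_sub, Polynomial.eval_mul, Polynomial.eval_C, Polynomial.eval_X, Polynomial.eval_C]
  have key : ∀ w : ΩU s m, w ≠ 0 → L.eval w = R.eval w := by
    intro w hw
    rw [hLe, hRe]
    have hwD : w ^ D = ∏ _i : Fin D, w := by simp
    -- `w^D S(y/w)` computed in two ways
    have h1 : S.eval (y / w) * w ^ D = ∑ t ∈ Finset.range (D + 1), S.coeff t * y ^ t * w ^ (D - t) := by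
      rw [Polynomial.eval_eq_sum_range' (lt_of_le_of_lt (natDegree_SPoly_le d Q₀ k) (Nat.lt_succ_self D)),
        Finset.sum_mul]
      refine Finset.sum_congr rfl fun t ht => ?_
      rw [Finset.mem_range] at ht
      have hsplit : w ^ D = w ^ t * w ^ (D - t) := by rw [← pow_add]; congr 1; omega
      rw [div_pow, hsplit]
      field_simp
      ring
    have h2 : S.eval (y / w) * w ^ D = splitConst 𝔭 s ^ d *
        ∏ i, (MvPolynomial.eval₂Hom (Int.castRingHom (ΩU s m)) (splitPts 𝔭 s i) Q₀ * w - y * splitPts 𝔭 s i k ^ d) := by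
      rw [hS, Polynomial.eval_mul, Polynomial.eval_C, Polynomial.eval_prod, mul_assoc, hwD,
        ← Finset.prod_mul_distrib]
      congr 1
      refine Finset.prod_congr rfl fun i _ => ?_
      rw [Polynomial.eval_sub, Polynomial.eval_C, Polynomial.eval_mul, Polynomial.eval_X, Polynomial.eval_C]
      field_simp
    rw [← h1, h2]
  -- hence `L = R`
  have hinf : Set.Infinite {w : ΩU s m | L.eval w = R.eval w} := by
    have h0 : Set.Infinite {w : ΩU s m | w ≠ 0} := by
      have : ({w : ΩU s m | w ≠ 0})ᶜ = {0} := by ext w; simp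
      refine Set.infinite_of_finite_compl ?_
      rw [this]; exact Set.finite_singleton 0
    exact h0.mono fun w hw => key w hw
  have hLR : L = R := Polynomial.eq_of_infinite_eval_eq L R hinf
  have h := congrArg (Polynomial.eval z) hLR
  rw [hLe, hRe] at h
  exact h

end Homog

/-! ### Vanishing of `P_k` at the generic point of the linear section -/

section Vanishing

variable (𝒢 : GSec m)

namespace GSec

set_option synthInstance.maxHeartbeats 200000 in
/-- **A copy of the generic section point inside `Ω = K'‾`**: an embedding `ψ : 𝕃₀ → Ω` over `K'`
(both are algebraic over `K'`) sends `ρ` to a point `β* = ψ(ρ)` of the generic linear section of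
`V(𝔭)` with `β*_j = 1`. [folklore] -/
theorem exists_lift_secPoint :
    ∃ ψ : 𝒢.L0 →ₐ[𝒢.Kp] ΩU 𝒢.s m, (fun k => ψ (𝒢.rhoL0 k)) ∈ secPoints 𝒢.𝔭 𝒢.s ∧ ψ (𝒢.rhoL0 𝒢.j) = 1 := by
  let ψ : 𝒢.L0 →ₐ[𝒢.Kp] ΩU 𝒢.s m := IsAlgClosed.lift
  have hj : ψ (𝒢.rhoL0 𝒢.j) = 1 := by rw [rhoL0_j, map_one]
  refine ⟨ψ, ⟨?_, ?_, ?_⟩, hj⟩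
  · intro h
    have h1 := congr_fun h 𝒢.j
    rw [Pi.zero_apply] at h1
    rw [h1] at hj
    exact zero_ne_one hj
  · intro P hP
    have h := ringHom_aeval_rat (ψ : 𝒢.L0 →+* ΩU 𝒢.s m) 𝒢.rhoL0 P
    rw [𝒢.aeval_rhoL0_eq_zero hP, map_zero] at h
    exact h.symm
  · intro i
    have h := congrArg ψ (𝒢.sum_algebraMap_X_mul_rhoL0 i)
    rw [map_sum, map_zero] at h
    rw [← h]
    refine Finset.sum_congr rfl fun k _ => ?_
    rw [map_mul, AlgHom.commutes, mul_comm, uΩ, ← IsScalarTower.algebraMap_apply]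

/-- Such a point is proportional to one of the chosen section points `β⁽ⁱ⁾` of the splitting of
`F_Ω` (its linear form divides `F_Ω = c ∏ (β⁽ⁱ⁾ · w)`). [folklore] -/
theorem exists_splitPts_eq_smul {β : Fin (m + 1) → ΩU 𝒢.s m} (hβ : β ∈ secPoints 𝒢.𝔭 𝒢.s) :
    ∃ (i₀ : Fin (ideg 𝒢.𝔭 (𝒢.s + 1))) (lam : ΩU 𝒢.s m), splitPts 𝒢.𝔭 𝒢.s i₀ = lam • β := by
  classical
  obtain ⟨hc, hβs, hF⟩ := splitConst_spec 𝒢.prime 𝒢.hom 𝒢.rank (𝔭 := 𝒢.𝔭) (s := 𝒢.s)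
  have hdvd : ((∑ j, MvPolynomial.C (β j) * MvPolynomial.X j) : MvPolynomial (Fin (m + 1)) (ΩU 𝒢.s m)) ∣
      chowFormΩ 𝒢.𝔭 𝒢.s :=
    linK_dvd_of_forall_eval hβ.1 fun v hv =>
      (eval_chowFormΩ_eq_zero_iff 𝒢.prime 𝒢.hom 𝒢.rank v).mpr ⟨β, hβ, hv⟩
  rw [hF] at hdvd
  have hprime := prime_linK (K := ΩU 𝒢.s m) hβ.1
  rcases hprime.dvd_or_dvd hdvd with h | h
  · exfalso
    exact hprime.not_unit (isUnit_of_dvd_unit h ((isUnit_iff_ne_zero.mpr hc).map MvPolynomial.C))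
  · obtain ⟨i₀, -, hi₀⟩ := hprime.exists_mem_finset_dvd h
    obtain ⟨lam, hlam⟩ := eq_smul_of_linK_dvd_linK hβ.1 (hβs i₀).1 hi₀
    exact ⟨i₀, lam, hlam⟩

/-- `ξ = x̄ⱼ • ρ`. [folklore] -/
theorem xi_eq_smul_rho : 𝒢.xi = 𝒢.xi 𝒢.j • 𝒢.rho := by
  rw [rho_eq_smul_xi, smul_smul, xi, ← map_mul, mul_inv_cancel₀ 𝒢.xb_j_ne_zero, map_one, one_smul]

set_option synthInstance.maxHeartbeats 200000 in
/-- Forms at `ξ = x̄ⱼ ρ`: `R(ξ) = x̄ⱼ^n R(ρ)`. [folklore] -/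
theorem aeval_xi_eq {R : Rx m} {n : ℕ} (hR : R.IsHomogeneous n) :
    MvPolynomial.aeval 𝒢.xi R = 𝒢.xi 𝒢.j ^ n * MvPolynomial.aeval 𝒢.rho R := by
  conv_lhs => rw [𝒢.xi_eq_smul_rho]
  exact aeval_smul_of_isHomogeneous_rat hR _ _

set_option synthInstance.maxHeartbeats 200000 in
/-- `Φⱼ` on `ℚ[x̲]`, read in `𝕃`: evaluation at `ξ`. [folklore] -/
theorem algebraMap_pivotMap_rename_inr (R : Rx m) :
    algebraMap 𝒢.RUL 𝒢.LL (NesterenkoK.pivotMap 𝒢.𝔭 𝒢.s 𝒢.j (rename Sum.inr R)) = MvPolynomial.aeval 𝒢.xi R := by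
  rw [NesterenkoK.pivotMap_rename_inr, ← algebraMap_Lp_eq]
  have hφ : ((IsScalarTower.toAlgHom ℚ 𝒢.Lp 𝒢.LL).comp (IsScalarTower.toAlgHom ℚ (Rx m) 𝒢.Lp)) =
      MvPolynomial.aeval 𝒢.xi := by
    refine MvPolynomial.algHom_ext fun k => ?_
    rw [AlgHom.comp_apply, IsScalarTower.coe_toAlgHom', IsScalarTower.coe_toAlgHom', MvPolynomial.aeval_X]
    rfl
  have h := congrArg (fun f => f R) hφ
  simp only [AlgHom.comp_apply, IsScalarTower.coe_toAlgHom'] at h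
  exact h

/-- Integer forms read over `ℚ` are evaluated through `Int.castRingHom`. [folklore] -/
theorem aeval_map_intCastRingHom {A : Type*} [CommRing A] [Algebra ℚ A] {σ : Type*} (f : σ → A)
    (Q : MvPolynomial σ ℤ) :
    MvPolynomial.aeval f (MvPolynomial.map (Int.castRingHom ℚ) Q) = MvPolynomial.eval₂Hom (Int.castRingHom A) f Q := by
  rw [MvPolynomial.aeval_def, MvPolynomial.eval₂_map, MvPolynomial.coe_eval₂Hom]
  congr 1
  exact RingHom.ext_int _ _

set_option maxHeartbeats 800000 in
set_option synthInstance.maxHeartbeats 200000 in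
/-- **`Φⱼ(P_k) = 0`** for `P_k = ∑_t s_t Q₀^t x_k^{d(D−t)}`: in `𝕃`, `Φⱼ(P_k) = x̄ⱼ^{dD} ∑_t s_t Q₀(ρ)^t ρ_k^{d(D−t)}`,
and the sum vanishes because its image under `ψ : 𝕃₀ → Ω` is, by the homogenised identity,
`c^d ∏ᵢ (Q₀(β⁽ⁱ⁾) β*_k^d − Q₀(β*) β⁽ⁱ⁾ₖ^d)`, whose factor `i₀` with `β⁽ⁱ⁰⁾ = λ β*` is zero.
[cite: Nesterenko1977, §2 Lemma 6] -/
theorem pivotMap_PPoly_eq_zero {d : ℕ} {Q₀ : MvPolynomial (Fin (m + 1)) ℤ} (hQ₀ : Q₀.IsHomogeneous d)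
    (k : Fin (m + 1)) {sc : ℕ → RU 𝒢.s m}
    (hsc : ∀ n, algebraMap (RU 𝒢.s m) (ΩU 𝒢.s m) (sc n) =
      (Polynomial.C (splitConst 𝒢.𝔭 𝒢.s ^ d) *
        ∏ i, (Polynomial.C (MvPolynomial.eval₂Hom (Int.castRingHom (ΩU 𝒢.s m)) (splitPts 𝒢.𝔭 𝒢.s i) Q₀) -
          Polynomial.X * Polynomial.C (splitPts 𝒢.𝔭 𝒢.s i k ^ d))).coeff n) :
    NesterenkoK.pivotMap 𝒢.𝔭 𝒢.s 𝒢.j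
      (∑ t ∈ Finset.range (ideg 𝒢.𝔭 (𝒢.s + 1) + 1), rename Sum.inl (sc t) *
        rename Sum.inr (MvPolynomial.map (Int.castRingHom ℚ) Q₀ ^ t *
          X k ^ (d * (ideg 𝒢.𝔭 (𝒢.s + 1) - t)))) = 0 := by
  classical
  have hQℚhom : (MvPolynomial.map (Int.castRingHom ℚ) Q₀ : Rx m).IsHomogeneous d := hQ₀.map _
  have hRt : ∀ t, t < ideg 𝒢.𝔭 (𝒢.s + 1) + 1 →
      ((MvPolynomial.map (Int.castRingHom ℚ) Q₀ : Rx m) ^ t *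
        X k ^ (d * (ideg 𝒢.𝔭 (𝒢.s + 1) - t))).IsHomogeneous (d * ideg 𝒢.𝔭 (𝒢.s + 1)) := by
    intro t ht
    have h := (hQℚhom.pow t).mul ((isHomogeneous_X ℚ k).pow (d * (ideg 𝒢.𝔭 (𝒢.s + 1) - t)))
    have e : d * t + 1 * (d * (ideg 𝒢.𝔭 (𝒢.s + 1) - t)) = d * ideg 𝒢.𝔭 (𝒢.s + 1) := by
      rw [one_mul, ← Nat.mul_add]
      congr 1
      omega
    rwa [e] at h
  -- the generic point copied into `Ω`
  obtain ⟨ψ, hβsec, hβj⟩ := 𝒢.exists_lift_secPoint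
  obtain ⟨i₀, lam, hi₀⟩ := 𝒢.exists_splitPts_eq_smul hβsec
  -- `Φⱼ(P_k) = x̄ⱼ^{dD} · (image of Z)` in `𝕃`, term by term
  have hΦt : ∀ t, t < ideg 𝒢.𝔭 (𝒢.s + 1) + 1 →
      algebraMap 𝒢.RUL 𝒢.LL (NesterenkoK.pivotMap 𝒢.𝔭 𝒢.s 𝒢.j (rename Sum.inl (sc t) *
        rename Sum.inr ((MvPolynomial.map (Int.castRingHom ℚ) Q₀ : Rx m) ^ t *
          X k ^ (d * (ideg 𝒢.𝔭 (𝒢.s + 1) - t))))) =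
      𝒢.xi 𝒢.j ^ (d * ideg 𝒢.𝔭 (𝒢.s + 1)) * (𝒢.toLL (sc t) *
        (MvPolynomial.aeval 𝒢.rho (MvPolynomial.map (Int.castRingHom ℚ) Q₀ : Rx m) ^ t *
          𝒢.rho k ^ (d * (ideg 𝒢.𝔭 (𝒢.s + 1) - t)))) := by
    intro t ht
    rw [map_mul, map_mul, ← toRUL_apply, ← toLL_apply, algebraMap_pivotMap_rename_inr,
      𝒢.aeval_xi_eq (hRt t ht), map_mul, map_pow, map_pow, MvPolynomial.aeval_X]
    ring
  have hZt : ∀ t, algebraMap 𝒢.L0 𝒢.LL (algebraMap 𝒢.Kp 𝒢.L0 (algebraMap (RU 𝒢.s m) 𝒢.Kp (sc t)) *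
        (MvPolynomial.aeval 𝒢.rhoL0 (MvPolynomial.map (Int.castRingHom ℚ) Q₀ : Rx m) ^ t *
          𝒢.rhoL0 k ^ (d * (ideg 𝒢.𝔭 (𝒢.s + 1) - t)))) =
      𝒢.toLL (sc t) * (MvPolynomial.aeval 𝒢.rho (MvPolynomial.map (Int.castRingHom ℚ) Q₀ : Rx m) ^ t *
        𝒢.rho k ^ (d * (ideg 𝒢.𝔭 (𝒢.s + 1) - t))) := by
    intro t
    rw [map_mul, map_mul, map_pow, map_pow, ringHom_aeval_rat (algebraMap 𝒢.L0 𝒢.LL) 𝒢.rhoL0,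
      ← IsScalarTower.algebraMap_apply 𝒢.Kp 𝒢.L0 𝒢.LL, ← IsScalarTower.algebraMap_apply (RU 𝒢.s m) 𝒢.Kp 𝒢.LL]
    rfl
  -- the image of `Z` under `ψ` vanishes
  have hψt : ∀ t ∈ Finset.range (ideg 𝒢.𝔭 (𝒢.s + 1) + 1),
      ψ (algebraMap 𝒢.Kp 𝒢.L0 (algebraMap (RU 𝒢.s m) 𝒢.Kp (sc t)) *
          (MvPolynomial.aeval 𝒢.rhoL0 (MvPolynomial.map (Int.castRingHom ℚ) Q₀ : Rx m) ^ t *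
            𝒢.rhoL0 k ^ (d * (ideg 𝒢.𝔭 (𝒢.s + 1) - t)))) =
        (Polynomial.C (splitConst 𝒢.𝔭 𝒢.s ^ d) *
          ∏ i, (Polynomial.C (MvPolynomial.eval₂Hom (Int.castRingHom (ΩU 𝒢.s m)) (splitPts 𝒢.𝔭 𝒢.s i) Q₀) -
            Polynomial.X * Polynomial.C (splitPts 𝒢.𝔭 𝒢.s i k ^ d))).coeff t *
          (MvPolynomial.eval₂Hom (Int.castRingHom (ΩU 𝒢.s m)) (fun k => ψ (𝒢.rhoL0 k)) Q₀) ^ t *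
            (ψ (𝒢.rhoL0 k) ^ d) ^ (ideg 𝒢.𝔭 (𝒢.s + 1) - t) := by
    intro t _
    have hψa : ψ (MvPolynomial.aeval 𝒢.rhoL0 (MvPolynomial.map (Int.castRingHom ℚ) Q₀ : Rx m)) =
        MvPolynomial.aeval (fun k => ψ (𝒢.rhoL0 k)) (MvPolynomial.map (Int.castRingHom ℚ) Q₀ : Rx m) :=
      ringHom_aeval_rat (ψ : 𝒢.L0 →+* ΩU 𝒢.s m) 𝒢.rhoL0 _
    have hψc : ψ (algebraMap 𝒢.Kp 𝒢.L0 (algebraMap (RU 𝒢.s m) 𝒢.Kp (sc t))) =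
        algebraMap (RU 𝒢.s m) (ΩU 𝒢.s m) (sc t) := by
      rw [AlgHom.commutes, ← IsScalarTower.algebraMap_apply]
    rw [map_mul, map_mul, map_pow, map_pow, hψc, hsc t, hψa, aeval_map_intCastRingHom, pow_mul, mul_assoc]
  have hψZ : ψ (∑ t ∈ Finset.range (ideg 𝒢.𝔭 (𝒢.s + 1) + 1),
      algebraMap 𝒢.Kp 𝒢.L0 (algebraMap (RU 𝒢.s m) 𝒢.Kp (sc t)) *
        (MvPolynomial.aeval 𝒢.rhoL0 (MvPolynomial.map (Int.castRingHom ℚ) Q₀ : Rx m) ^ t *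
          𝒢.rhoL0 k ^ (d * (ideg 𝒢.𝔭 (𝒢.s + 1) - t)))) = 0 := by
    rw [map_sum, Finset.sum_congr rfl hψt, SPoly_homog d Q₀ k]
    refine mul_eq_zero_of_right _ (Finset.prod_eq_zero (Finset.mem_univ i₀) ?_)
    -- the `i₀`-th factor vanishes: `β⁽ⁱ⁰⁾ = λ β*`
    have h1 := aeval_smul_of_isHomogeneous_int hQ₀ lam (fun k => ψ (𝒢.rhoL0 k))
    rw [aeval_eq_eval₂Hom_int, aeval_eq_eval₂Hom_int, ← hi₀] at h1
    have h2 : splitPts 𝒢.𝔭 𝒢.s i₀ k = lam * ψ (𝒢.rhoL0 k) := by rw [hi₀]; rfl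
    rw [h1, h2, mul_pow]
    ring
  have hZ0 : (∑ t ∈ Finset.range (ideg 𝒢.𝔭 (𝒢.s + 1) + 1),
      algebraMap 𝒢.Kp 𝒢.L0 (algebraMap (RU 𝒢.s m) 𝒢.Kp (sc t)) *
        (MvPolynomial.aeval 𝒢.rhoL0 (MvPolynomial.map (Int.castRingHom ℚ) Q₀ : Rx m) ^ t *
          𝒢.rhoL0 k ^ (d * (ideg 𝒢.𝔭 (𝒢.s + 1) - t)))) = 0 :=
    (injective_iff_map_eq_zero ψ).mp ψ.toRingHom.injective _ hψZ
  -- conclude in `𝕃`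
  apply IsFractionRing.injective 𝒢.RUL 𝒢.LL
  rw [map_zero, map_sum, map_sum, Finset.sum_congr rfl (fun t ht => hΦt t (Finset.mem_range.mp ht)),
    ← Finset.mul_sum]
  refine mul_eq_zero_of_right _ ?_
  have h := congrArg (algebraMap 𝒢.L0 𝒢.LL) hZ0
  rw [map_sum, map_zero] at h
  rw [← h]
  exact Finset.sum_congr rfl fun t _ => (hZt t).symm

end GSec

end Vanishing

/-! ### Lemma 2.3.3 (i): `G ∈ ((𝔭, Q))‾(s)` -/

section Main

variable {s : ℕ} {𝔭 : Ideal (Rx m)}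

/-- `(𝔭, L₁, …, L_s) ⊆ ((𝔭, Q), L₁, …, L_s)`. [folklore] -/
theorem extIdeal_le_extIdeal_sup (Q : Rx m) (s : ℕ) :
    NesterenkoK.extIdeal 𝔭 s ≤ NesterenkoK.extIdeal (𝔭 ⊔ Ideal.span {Q}) s :=
  sup_le_sup_right (Ideal.map_mono le_sup_left) _

/-- `Q ∈ ((𝔭, Q), L₁, …, L_s)` (as a polynomial in `u, x`). [folklore] -/
theorem rename_inr_mem_extIdeal_sup {I : Ideal (Rx m)} {Q : Rx m} (hQ : Q ∈ I) (s : ℕ) :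
    rename Sum.inr Q ∈ NesterenkoK.extIdeal I s :=
  le_sup_left (α := Ideal (RUX s m)) (Ideal.mem_map_of_mem _ hQ)

/-- **Zhu, Lemma 2.3.3 (i) / Nesterenko 1977, Lemma 6: the `u`-resultant of `𝔭` and `Q` lies in
the elimination ideal `((𝔭, Q))‾(s)`** — for every `k`, `G x_k^M ∈ (𝔭, Q, L₁, …, L_s)`. For `x_k ∉ 𝔭`:
`x_k^N P_k ∈ (𝔭, L₁, …, L_s)` by `Φ_k(P_k) = 0` (`pivotMap_PPoly_eq_zero`, chart independence,
`exists_pow_mul_mem_extIdeal`), and `P_k ≡ x_k^{dD} G (mod Q)`; for `x_k ∈ 𝔭` it is trivial.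
[cite: Nesterenko1977, §2 Lemma 6] -/
theorem uResultant_mem_elimIdeal_sup (hs : 1 ≤ s) (h𝔭 : 𝔭.IsPrime)
    (hhom : 𝔭.IsHomogeneous (homogeneousSubmodule (Fin (m + 1)) ℚ)) (hunm : IsUnmixedOfRank 𝔭 (s + 1))
    {Q : Rx m} {d : ℕ} {q : ℚ} {Q₀ : MvPolynomial (Fin (m + 1)) ℤ} (hq : q ≠ 0)
    (hQQ₀ : Q = C q * MvPolynomial.map (Int.castRingHom ℚ) Q₀) (hQ₀ : Q₀.IsHomogeneous d) :
    uResultant 𝔭 s d Q₀ ∈ elimIdeal (𝔭 ⊔ Ideal.span {Q}) s := by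
  classical
  haveI := h𝔭
  have hdim : ringKrullDim (Rx m ⧸ 𝔭) = (s + 1 : ℕ) :=
    PhilipponMain.ringKrullDim_quotient_eq_of_isUnmixedOfRank h𝔭 hunm
  obtain ⟨j, hj⟩ := exists_X_notMem_of_rank h𝔭 (r := s + 1) (by omega) hdim
  let 𝒢 : GSec m := ⟨𝔭, s, j, h𝔭, hhom, hj, hdim⟩
  -- `Q₀` (over `ℚ`) lies in `(𝔭, Q)`
  have hQℚmem : (MvPolynomial.map (Int.castRingHom ℚ) Q₀ : Rx m) ∈ 𝔭 ⊔ Ideal.span {Q} := by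
    refine Ideal.mem_sup_right (Ideal.mem_span_singleton'.mpr ⟨C q⁻¹, ?_⟩)
    rw [hQQ₀, ← mul_assoc, ← C_mul, inv_mul_cancel₀ hq, C_1, one_mul]
  -- for every coordinate `k`, a power of `x_k` multiplies `G` into `((𝔭, Q), L)`
  have hk : ∀ k : Fin (m + 1), ∃ N : ℕ,
      X (Sum.inr k) ^ N * rename Sum.inl (uResultant 𝔭 s d Q₀) ∈ NesterenkoK.extIdeal (𝔭 ⊔ Ideal.span {Q}) s := by
    intro k
    by_cases hXk : (X k : Rx m) ∈ 𝔭
    · refine ⟨1, ?_⟩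
      rw [pow_one]
      refine Ideal.mul_mem_right _ _ (extIdeal_le_extIdeal_sup Q s ?_)
      have : (X (Sum.inr k) : RUX s m) = rename Sum.inr (X k) := by rw [rename_X]
      rw [this]
      exact le_sup_left (α := Ideal (RUX s m)) (Ideal.mem_map_of_mem _ hXk)
    · obtain ⟨sc, hsc, hsc0⟩ := exists_SPoly_coeff h𝔭 hhom hdim hQ₀ k
      have hP0 : NesterenkoK.pivotMap 𝔭 s j
          (∑ t ∈ Finset.range (ideg 𝔭 (s + 1) + 1), rename Sum.inl (sc t) *
            rename Sum.inr ((MvPolynomial.map (Int.castRingHom ℚ) Q₀ : Rx m) ^ t *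
              X k ^ (d * (ideg 𝔭 (s + 1) - t)))) = 0 :=
        𝒢.pivotMap_PPoly_eq_zero hQ₀ k hsc
      rw [NesterenkoK.pivotMap_eq_zero_iff_pivotMap_eq_zero 𝔭 hj hXk] at hP0
      obtain ⟨N, hN⟩ := NesterenkoK.exists_pow_mul_mem_extIdeal 𝔭 hXk hP0
      refine ⟨N + d * ideg 𝔭 (s + 1), ?_⟩
      -- split off the term `t = 0`
      rw [Finset.sum_range_succ', mul_add] at hN
      have htail : X (Sum.inr k) ^ N * ∑ t ∈ Finset.range (ideg 𝔭 (s + 1)), rename Sum.inl (sc (t + 1)) *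
          rename Sum.inr ((MvPolynomial.map (Int.castRingHom ℚ) Q₀ : Rx m) ^ (t + 1) *
            X k ^ (d * (ideg 𝔭 (s + 1) - (t + 1)))) ∈
            NesterenkoK.extIdeal (𝔭 ⊔ Ideal.span {Q}) s := by
        refine Ideal.mul_mem_left _ _ (Ideal.sum_mem _ fun t _ => ?_)
        rw [pow_succ, map_mul, map_mul]
        have hmem := rename_inr_mem_extIdeal_sup hQℚmem s
        have e : rename Sum.inl (sc (t + 1)) *
            (rename Sum.inr ((MvPolynomial.map (Int.castRingHom ℚ) Q₀ : Rx m) ^ t) *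
              rename Sum.inr (MvPolynomial.map (Int.castRingHom ℚ) Q₀ : Rx m) *
              rename Sum.inr (X k ^ (d * (ideg 𝔭 (s + 1) - (t + 1))))) =
            (rename Sum.inl (sc (t + 1)) * rename Sum.inr ((MvPolynomial.map (Int.castRingHom ℚ) Q₀ : Rx m) ^ t) *
              rename Sum.inr (X k ^ (d * (ideg 𝔭 (s + 1) - (t + 1))))) *
              rename Sum.inr (MvPolynomial.map (Int.castRingHom ℚ) Q₀ : Rx m) := by ring
        rw [e]
        exact Ideal.mul_mem_left _ _ hmem
      have hhead : X (Sum.inr k) ^ N * (rename Sum.inl (sc 0) *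
          rename Sum.inr ((MvPolynomial.map (Int.castRingHom ℚ) Q₀ : Rx m) ^ 0 * X k ^ (d * (ideg 𝔭 (s + 1) - 0)))) =
          X (Sum.inr k) ^ (N + d * ideg 𝔭 (s + 1)) * rename Sum.inl (uResultant 𝔭 s d Q₀) := by
        rw [hsc0, pow_zero, one_mul, Nat.sub_zero, map_pow, rename_X, pow_add]
        ring
      have h := (NesterenkoK.extIdeal (𝔭 ⊔ Ideal.span {Q}) s).sub_mem (extIdeal_le_extIdeal_sup Q s hN) htail
      rwa [add_sub_cancel_left, hhead] at h
  choose N hN using hk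
  refine ⟨1 + ∑ k, N k, by omega, fun k => ?_⟩
  have hle : N k ≤ 1 + ∑ k, N k :=
    le_add_left (Finset.single_le_sum (fun _ _ => Nat.zero_le _) (Finset.mem_univ k))
  obtain ⟨e, he⟩ := Nat.exists_eq_add_of_le hle
  rw [he, pow_add, mul_comm, mul_assoc, mul_comm (X (Sum.inr k) ^ e), ← mul_assoc]
  exact Ideal.mul_mem_right _ _ (hN k)

end Main

end Nesterenko

end Literature.NumberTheory.Transcendental

end
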